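import Summits.Ventures.DiscreteObjects.Hadamard.NormalizerPrimeMain

/-!
# H(668): EVERY automorphism normalising an element of order 167 acts on it as `±1` (kernel EXCLUSION) — the Frobenius group
# `C₁₆₇ ⋊ C₈₃` is not a group of signed automorphisms of a Hadamard matrix of order 668

Framing: lottery ticket; floor = certified bounds/negative ranges.

Cell pub-namedobj (venture DiscreteObjects), target (H), hadamard gen 20.  Let `σ = (π, κ, d, e)` be a signed automorphism of a
Hadamard matrix `H` of order `668` with `π^167 = κ^167 = 1`, `(π, κ) ≠ (1, 1)` — fixed-point-free with `4 + 4` orbits ('blocks') of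
length `167` (gen 9) — and `τ = (π', κ', d', e')` a signed automorphism normalising its permutation pair with multiplier `μ`
(`π'π = π^μ π'`, `κ'κ = κ^μ κ'`) which keeps some row `x₀` inside its `σ`-orbit and EVERY column inside its `σ`-orbit (block-preserving).
* (`NormalizerPrimeMain.normalizing_prime_main` at `p = 167`): the four `±1` sequences `t ↦ H' x₀ (κ^t y_q)` read at `x₀` along a
  transversal of the column orbits (re-signed matrix `H'`) form a Goethals–Seidel family (`Σ_q PAF = 0` off `0`, no fixed column) each
  member of which is translation-twisted `μ`-invariant.
* **`inv4_of_hInvariant`**: in `ZMod 167` a sequence invariant under a unit `u` with `u² ≠ 1` is invariant under `4` (by the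
  orbit table of `QRBlocks167`, `u = ±4^j` with `83 ∤ j`, and `4 ∈ ⟨4^{2j}⟩`); recentring (`NormalizerOrbitTools.exists_translate_hInvariant_prime`):
  a twisted-invariant sequence has an invariant translate when `u ≠ 1` (fixed point of the affine map; `167` is prime).
* **`hadamard668_order167_normalizer_sq_eq_one`** (EXCLUSION): under the hypotheses above, **`μ² ≡ 1 (mod 167)`**.  [Otherwise
  recentre the four sequences (PAF is translation invariant): a Goethals–Seidel quadruple over `ZMod 167` with square-invariant
  blocks — excluded in the kernel by `no_gs_quad_qr167` (gen 4: `PAF(1) ∈ {−1, 163, 167}` for each block).]  Equivalently: no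
  Hadamard matrix of order 668 admits the Frobenius group `C₁₆₇ ⋊ C₈₃` (or `C₁₆₇ ⋊ C₁₆₆`, or any `C₁₆₇ ⋊ C_m`, `m ∤ 2`) as a group
  of signed automorphisms in which the complement fixes the `C₁₆₇`-orbits — the reduction that FAMILY-F12 §6 (gen 4) did on paper is
  now a kernel theorem.
* **`norm_pow24_mem_orbFin`**, **`hadamard668_order167_normalizer_sq_eq_one_general`** (GENERAL `τ`, no block hypothesis): a normalising
  `ψ` permutes the four `κ`-orbits, so `ψ^24` (`24 = 4!`) preserves them (`NormalizerOrbitTools.norm_pow_factorial_mem_orbFin`); `τ^24`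
  is block-preserving with multiplier `μ^24`, hence `μ^48 ≡ 1`, and with Fermat `μ^166 ≡ 1`, `gcd(48,166) = 2`: **`μ² ≡ 1 (mod 167)` for
  EVERY normalising `τ`**.  So for a HYPOTHETICAL H(668) an element of order 167 is centralised or inverted by whatever normalises it
  (`N(⟨σ⟩)/C(⟨σ⟩) ≤ C₂`); **no H(668) admits `C₁₆₇ ⋊ C₈₃` (nor `C₁₆₇ ⋊ C₁₆₆`, nor any `C₁₆₇ ⋊_φ C_m` with `φ` of order `> 2`) as a group
  of signed automorphisms** (pair level).  By contrast Paley-type H(p+1) carries `C_p ⋊ C_{(p−1)/2}`.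
EXCLUSION of a symmetry type of a hypothetical object; no Hadamard ORDER excluded; H(668) untouched; HITS 0/4.  Ours; no `sorry`,
no definitions.
-/

namespace Summit.Ventures.DiscreteObjects.Hadamard

open Finset BigOperators Matrix

open Literature.Combinatorics.Designs.GoethalsSeidel (IsHadamardMatrix)
open Literature.Combinatorics.Designs.LegendrePairs (PAF IsPM TwistedInvariant HInvariant PAF_translate)

variable {ι : Type*} [Fintype ι] [DecidableEq ι]

/-! ### number theory in `ZMod 167`: squares are powers of `4`; recentring -/

/-- the orbit walk of `QRBlocks167` is the power map: `orb k = 4^k` -/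
lemma orb_eq_pow (k : ℕ) : orb k = 4 ^ k := by
  induction k with
  | zero => rfl
  | succ k ih => show 4 * orb k = _; rw [ih, pow_succ']

/-- **a sequence on `ZMod 167` invariant under a unit `u` with `u² ≠ 1` is invariant under `4`** (hence under all non-zero squares) -/
theorem inv4_of_hInvariant {α : Type*} (x : ZMod 167 → α) (u : (ZMod 167)ˣ) (hsq : (u : ZMod 167) ^ 2 ≠ 1)
    (h : ∀ i, x ((u : ZMod 167) * i) = x i) : ∀ i, x (4 * i) = x i := by
  have h83 : (4 : ZMod 167) ^ 83 = 1 := by rw [← orb_eq_pow]; exact orb_83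
  have hu0 : (u : ZMod 167) ≠ 0 := fun h0 => by
    have h1 := u.mul_inv; rw [h0, zero_mul] at h1; exact absurd h1 (by decide)
  obtain ⟨j₀, hj₀⟩ : ∃ j : ℕ, (u : ZMod 167) = 4 ^ j ∨ (u : ZMod 167) = -(4 ^ j) := by
    rcases orbit_cover (u : ZMod 167) with h0 | ⟨-, he⟩ | ⟨-, he⟩
    · exact absurd h0 hu0
    · exact ⟨_, Or.inl (by rw [← he, orb_eq_pow])⟩
    · exact ⟨_, Or.inr (by rw [← orb_eq_pow, he, neg_neg])⟩
  have husq : (u : ZMod 167) ^ 2 = 4 ^ (2 * j₀) := by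
    rcases hj₀ with h1 | h1 <;> rw [h1] <;> ring
  have hj83 : ¬ 83 ∣ j₀ := by
    rintro ⟨q, rfl⟩
    apply hsq
    rw [husq, show 2 * (83 * q) = 83 * (2 * q) by ring, pow_mul, h83, one_pow]
  have hcop : Nat.Coprime (2 * j₀) 83 :=
    Nat.Coprime.mul_left (by norm_num) ((Nat.Prime.coprime_iff_not_dvd (by norm_num : Nat.Prime 83)).mpr hj83).symm
  obtain ⟨m, -, hm⟩ := Nat.exists_mul_mod_eq_one_of_coprime hcop (by norm_num : 1 < 83)
  have h2 : ∀ i, x ((u : ZMod 167) ^ 2 * i) = x i := fun i => by rw [sq, mul_assoc, h, h]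
  have hpow : ∀ k : ℕ, ∀ i, x (((u : ZMod 167) ^ 2) ^ k * i) = x i := by
    intro k; induction k with
    | zero => intro i; simp
    | succ k ih => intro i; rw [pow_succ, mul_assoc, ih, h2]
  have h4 : ((u : ZMod 167) ^ 2) ^ m = 4 := by
    have hdm := Nat.div_add_mod (2 * j₀ * m) 83
    rw [husq, ← pow_mul, show 2 * j₀ * m = 83 * (2 * j₀ * m / 83) + 1 by omega, pow_add, pow_mul, h83, one_pow,
      one_mul, pow_one]
  intro i
  rw [← h4]; exact hpow m i

omit [Fintype ι] in
/-- a Goethals–Seidel family over a 4-element index set with square-invariant members is impossible (`no_gs_quad_qr167` unpacked) -/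
lemma no_gs_family_qr167 {T : Finset ι} (hT4 : T.card = 4) (x : ι → ZMod 167 → ℤ) (hpm : ∀ y ∈ T, IsPM (x y))
    (hpaf : ∀ s : ZMod 167, s ≠ 0 → ∑ y ∈ T, PAF (x y) s = 0) (h4 : ∀ y ∈ T, ∀ i, x y (4 * i) = x y i) : False := by
  obtain ⟨y₁, T₁, hy₁, rfl, hT₁⟩ := Finset.card_eq_succ.mp hT4
  obtain ⟨y₂, y₃, y₄, h23, h24, h34, rfl⟩ := Finset.card_eq_three.mp hT₁
  have m1 : y₁ ∈ insert y₁ ({y₂, y₃, y₄} : Finset ι) := Finset.mem_insert_self _ _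
  have m2 : y₂ ∈ insert y₁ ({y₂, y₃, y₄} : Finset ι) := by simp
  have m3 : y₃ ∈ insert y₁ ({y₂, y₃, y₄} : Finset ι) := by simp
  have m4 : y₄ ∈ insert y₁ ({y₂, y₃, y₄} : Finset ι) := by simp
  refine no_gs_quad_qr167 (x y₁) (x y₂) (x y₃) (x y₄) (hpm _ m1) (hpm _ m2) (hpm _ m3) (hpm _ m4)
    (h4 _ m1) (h4 _ m2) (h4 _ m3) (h4 _ m4) (fun s hs => ?_)
  have h := hpaf s hs
  have hn2 : y₂ ∉ ({y₃, y₄} : Finset ι) := by simp [h23, h24]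
  rw [Finset.sum_insert hy₁, Finset.sum_insert hn2, Finset.sum_pair h34] at h
  linarith

/-! ### the exclusion -/

section main
variable {H : Matrix ι ι ℤ}

/-- **EXCLUSION (order 167, block-preserving normalisers act as `±1`).**  For a signed automorphism `σ = (π, κ, d, e)` of a
Hadamard matrix of order `668` of pair order `167` and a signed automorphism `τ` with `π'π = π^μ π'`, `κ'κ = κ^μ κ'` keeping some
row and every column inside its `σ`-orbit: **`μ² ≡ 1 (mod 167)`**.  In particular no H(668) carries the Frobenius group
`C₁₆₇ ⋊ C₈₃` acting with the `C₈₃` fixing the orbits of the `C₁₆₇`. -/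
theorem hadamard668_order167_normalizer_sq_eq_one (hH : IsHadamardMatrix H) (hι : Fintype.card ι = 668)
    {π κ π' κ' : Equiv.Perm ι} {d e d' e' : ι → ℤ} (haut : IsSignedAut H π κ d e)
    (hπ : π ^ 167 = 1) (hκ : κ ^ 167 = 1) (hne : π ≠ 1 ∨ κ ≠ 1)
    (haut' : IsSignedAut H π' κ' d' e') {μ : ℕ} (hnπ : π' * π = π ^ μ * π') (hnκ : κ' * κ = κ ^ μ * κ')
    {x₀ : ι} (hrow : π' x₀ ∈ orbFin π 167 x₀) (hcols : ∀ y, κ' y ∈ orbFin κ 167 y) :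
    (μ : ZMod 167) ^ 2 = 1 := by
  haveI : Fact (Nat.Prime 167) := ⟨by norm_num⟩
  by_contra hsq
  have h167 := hadamard668_fixedRows_167 hH hι π κ d e haut hπ hκ hne
  have hx₀ : π x₀ ≠ x₀ := moved_of_card_fixed_eq_zero π h167.1 x₀
  obtain ⟨u, T, x, hu, hTc, hpm, hgs, htw⟩ := normalizing_prime_main (by norm_num : Nat.Prime 167) (by decide : Odd 167)
    hH haut hπ hκ hne haut' hnπ hnκ hx₀ hrow (fun y _ => hcols y)
  rw [card_moved_of_card_fixed_eq_zero κ h167.2.1, hι] at hTc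
  have hT4 : T.card = 4 := by omega
  rw [h167.2.1] at hgs
  rw [← hu] at hsq
  have hu1 : (u : ZMod 167) ≠ 1 := fun h => hsq (by rw [h, one_pow])
  -- recentre every sequence
  have hrec : ∀ y ∈ T, ∃ δ : ZMod 167, HInvariant (Literature.Combinatorics.Designs.LegendrePairs.translate (x y) δ) u :=
    fun y hy => exists_translate_hInvariant_prime (x y) u hu1 (htw y hy)
  choose! δ hδ using hrec
  refine no_gs_family_qr167 hT4 (fun y => Literature.Combinatorics.Designs.LegendrePairs.translate (x y) (δ y))
    (fun y hy r => hpm y hy _) (fun z hz => ?_) (fun y hy => ?_)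
  · rw [Finset.sum_congr rfl fun y _ => PAF_translate (x y) (δ y) z]; simpa using hgs z hz
  · exact inv4_of_hInvariant _ u hsq (hδ y hy)

end main

/-! ### the general case: `τ^24` preserves the blocks -/

/-- **`ψ^24` preserves the blocks.**  If `ψ` normalises a fixed-point-free permutation `κ` of exponent `167` on `668` points
(four orbits of length `167`), then `ψ^24` maps every point into its own `κ`-orbit. -/
theorem norm_pow24_mem_orbFin (hι : Fintype.card ι = 668) {κ ψ : Equiv.Perm ι} {μ : ℕ} (hn : ψ * κ = κ ^ μ * ψ)
    (hκ : κ ^ 167 = 1) (hfix : ∀ y, κ y ≠ y) : ∀ y, (ψ ^ 24) y ∈ orbFin κ 167 y := by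
  have p167 : Nat.Prime 167 := by norm_num
  have hfree : ∀ y, κ y ≠ y → ∀ k, 0 < k → k < 167 → (κ ^ k) y ≠ y :=
    fun y hy => free_of_fixed_prime_pow κ p167 (by rw [hκ, Equiv.Perm.one_apply]) hy
  have hstab : ∀ y ∈ univ.filter (fun y => κ y ≠ y), κ y ∈ univ.filter (fun y => κ y ≠ y) := by
    intro y hy; rw [Finset.mem_filter] at hy ⊢; exact ⟨Finset.mem_univ _, fun h => hy.2 (κ.injective h)⟩
  obtain ⟨T, hTsub, hTc, hT⟩ := exists_free_transversal κ (by norm_num : 0 < 167) _ (univ.filter fun y => κ y ≠ y) le_rfl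
    hstab (fun y _ => by rw [hκ, Equiv.Perm.one_apply]) (fun y hy => hfree y (Finset.mem_filter.mp hy).2)
  have hall : (univ.filter fun y => κ y ≠ y) = univ := Finset.filter_true_of_mem fun y _ => hfix y
  rw [hall, Finset.card_univ, hι] at hTc
  have hT4 : T.card = 4 := by omega
  obtain ⟨y⟩ : Nonempty ι := Fintype.card_pos_iff.mp (by rw [hι]; norm_num)
  have hne : κ ≠ 1 := fun h => hfix y (by rw [h, Equiv.Perm.one_apply])
  have h := norm_pow_factorial_mem_orbFin p167 hn hκ hne T hTsub hT
  rw [hT4, show Nat.factorial 4 = 24 by rfl] at h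
  exact fun y => h y (hfix y)

section main
variable {H : Matrix ι ι ℤ}

/-- **EXCLUSION (order 167, general normalisers act as `±1`).**  For a signed automorphism `σ = (π, κ, d, e)` of a Hadamard
matrix of order `668` with `π^167 = κ^167 = 1`, `(π, κ) ≠ (1, 1)`, and ANY signed automorphism `τ = (π', κ', d', e')` with
`π'π = π^μ π'`, `κ'κ = κ^μ κ'`: **`μ² ≡ 1 (mod 167)`**.  No Hadamard matrix of order 668 has the Frobenius group `C₁₆₇ ⋊ C₈₃`
among its signed automorphisms. -/
theorem hadamard668_order167_normalizer_sq_eq_one_general (hH : IsHadamardMatrix H) (hι : Fintype.card ι = 668)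
    {π κ π' κ' : Equiv.Perm ι} {d e d' e' : ι → ℤ} (haut : IsSignedAut H π κ d e)
    (hπ : π ^ 167 = 1) (hκ : κ ^ 167 = 1) (hne : π ≠ 1 ∨ κ ≠ 1)
    (haut' : IsSignedAut H π' κ' d' e') {μ : ℕ} (hnπ : π' * π = π ^ μ * π') (hnκ : κ' * κ = κ ^ μ * κ') :
    (μ : ZMod 167) ^ 2 = 1 := by
  haveI : Fact (Nat.Prime 167) := ⟨by norm_num⟩
  have h167 := hadamard668_fixedRows_167 hH hι π κ d e haut hπ hκ hne
  have hπfix : ∀ x, π x ≠ x := moved_of_card_fixed_eq_zero π h167.1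
  have hκfix : ∀ y, κ y ≠ y := moved_of_card_fixed_eq_zero κ h167.2.1
  obtain ⟨x₀⟩ : Nonempty ι := Fintype.card_pos_iff.mp (by rw [hι]; norm_num)
  -- τ^24 is block-preserving with multiplier μ^24
  have h48 := hadamard668_order167_normalizer_sq_eq_one hH hι haut hπ hκ hne (isSignedAut_pow haut' 24)
    (norm_pow_left hnπ 24) (norm_pow_left hnκ 24) (norm_pow24_mem_orbFin hι hnπ hπ hπfix x₀)
    (norm_pow24_mem_orbFin hι hnκ hκ hκfix)
  push_cast at h48
  rw [← pow_mul] at h48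
  -- μ ≠ 0 in ZMod 167
  have hμ0 : (μ : ZMod 167) ≠ 0 := by
    intro h0
    rw [ZMod.natCast_eq_zero_iff] at h0
    obtain ⟨m, rfl⟩ := h0
    have h1 := hnκ
    rw [pow_mul, hκ, one_pow, one_mul] at h1
    have h2 : κ' * κ = κ' * 1 := by rw [h1, mul_one]
    have h3 : κ = 1 := mul_left_cancel h2
    have h1' := hnπ
    rw [pow_mul, hπ, one_pow, one_mul] at h1'
    have h2' : π' * π = π' * 1 := by rw [h1', mul_one]
    have h3' : π = 1 := mul_left_cancel h2'
    rcases hne with h | h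
    · exact h h3'
    · exact h h3
  have h166 : (μ : ZMod 167) ^ 166 = 1 := ZMod.pow_card_sub_one_eq_one hμ0
  calc (μ : ZMod 167) ^ 2 = (μ : ZMod 167) ^ 2 * ((μ : ZMod 167) ^ (24 * 2)) ^ 38 := by rw [h48, one_pow, mul_one]
    _ = ((μ : ZMod 167) ^ 166) ^ 11 := by ring
    _ = 1 := by rw [h166, one_pow]

end main

end Summit.Ventures.DiscreteObjects.Hadamard
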